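import Literature.Analysis.FluidPDE.KNSSRegularityDecomposition
import Literature.Analysis.FluidPDE.KNSSRegularityAncient
import Literature.Analysis.FluidPDE.VorticityCalculus
import Mathlib.MeasureTheory.Integral.IntervalIntegral.AbsolutelyContinuousFun
import Mathlib.MeasureTheory.Integral.IntervalIntegral.LebesgueDifferentiationThm
import HarnessLib

/-!
# KNSS 2009, §4: the drift is a Galilean artefact — reduction of the regularity of drift-mild
# pairs to the regularity of bounded mild solutions

Analysis/FluidPDE file (proved reduction + two named propositions) on the discharge path of the
named facts `Literature.Analysis.FluidPDE.KNSS2009_regularity_boundedWeak_ancient`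
(`KNSSRegularity`; Koch–Nadirashvili–Seregin–Šverák, Acta Math. 203 (2009) = arXiv:0709.3599v1,
§4 for bounded weak solutions on `ℝ³ × (−∞, 0)`, the input "by the results of Section 4" of the
proofs of Theorems 5.2–5.3), reduced in the tree to the finite-window fact
`KNSS2009_regularity_boundedWeak_window` (`KNSSRegularityAncient`), itself reduced
(`KNSSRegularityDecomposition`, `KNSS2009_regularity_boundedWeak_window_of_driftMild`) to
Lemma 3.1 in drift-mild form (`KNSS2009_weak_driftMild`) and the **smoothing half**
`KNSS2009_driftMild_regularity`: the bounds (4.10)–(4.11) and the vorticity equation (4.8) for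
every *drift-mild* pair `(U, b)`,
`U(t) = e^{(t−s)Δ}U(s) − ∫ₛᵗ e^{(t−σ)Δ}P∇·((U + b) ⊗ (U + b))(σ) dσ`, `u = U + b(t)`.

The one non-standard feature of the smoothing half is the **drift** `b(t)`, merely bounded
measurable: `U` is *not* a mild solution of Navier–Stokes (formally
`Uₜ = ΔU − P∇·(U⊗U) − (b·∇)U`), which is why the source routes the higher regularity of weak
solutions through Serrin's local `L^p` bootstrap ((3.11), (4.7), (4.9)) rather than through its own
Proposition 4.1 (smoothing of bounded mild solutions). This file shows that the drift is a
Galilean artefact and PROVES the reduction of the smoothing half to the zero-drift case: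

* `driftPath b = B = ∫₀ b`, `galileanShift U b (t, y) = U(t, y + B(t))` — the co-moving frame;
* `IsKNSSDriftMild.GalileanCovariance E` (named proposition, the tree's own lemma, to be proved
  from the `oseenHeat` calculus): the Galilean transform of a drift-mild pair is drift-mild with
  **zero** drift (an honest bounded mild solution) and the same bound;
* `KNSS2009_mild_regularity` (named fact = the case `b ≡ 0` of `KNSS2009_driftMild_regularity`,
  i.e. KNSS's Proposition 4.1 with (4.6) and the vorticity equation for bounded mild solutions;
  `KNSS2009_mild_regularity_of_driftMild` is the trivial converse);
* `KNSS2009_driftMild_regularity_of_mild : GalileanCovariance ℝ³ → KNSS2009_mild_regularity →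
  KNSS2009_driftMild_regularity` (**proved**), and the compositions down to the window and the
  ancient facts (`KNSS2009_regularity_boundedWeak_window_of_mild`,
  `KNSS2009_regularity_boundedWeak_ancient_of_mild`).

So the whole §4 input of Theorems 5.2–5.3 now rests on: Lemma 3.1 (`KNSS2009_weak_driftMild`),
Galilean covariance of the drift-mild identity, and the regularity of bounded mild solutions
(Prop. 4.1) — the last being the object of the tree's `L^∞` mild-solution programme
(`NSBoundedMildOseen*.lean`: restart (R), smoothing (P), classical (C, discharged);
`OseenHeatSemigroup`, `OseenHeatCommute`: "derivatives fall on the data").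

## The proof of the reduction (`KNSS2009_driftMild_regularity_of_mild`)

Given a drift-mild `(U, b)` with bound `N`, let `V = galileanShift U b` (mild, bound `N`, by
covariance) and take the constants `C(k, δ), L(k, δ)` of `KNSS2009_mild_regularity`. Since
`U(t, x) = V(t, x − B(t))`: smoothness and `div = 0` of slices and every bound `‖∇ᵏU‖ ≤ C(k, δ)`
transfer verbatim (`iteratedFDeriv_comp_sub_right`, `divergence_comp_sub_right`); the time
increment splits as `∇ᵏV(t, x − B(t)) − ∇ᵏV(s, x − B(t))` (bounded by `L(k, δ)|t − s|`) plus
`∇ᵏV(s, x − B(t)) − ∇ᵏV(s, x − B(s))` (mean value inequality with `‖∇ᵏ⁺¹V‖ ≤ C(k+1, δ)` over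
`‖B(t) − B(s)‖ ≤ N|t − s|`), whence the Lipschitz constant `L(k, δ) + C(k+1, δ)N`; and the
vorticity `ω(t, x) = ω_V(t, x − B(t))` is differentiated along the Lipschitz frame path by the
**moving-frame fundamental theorem of calculus** `sub_eq_integral_of_path` (for
`Φ(σ, ·) = Φ(s, ·) + ∫ₛ^σ φ(ρ, ·) dρ` with `φ`, `DΦ` jointly continuous and a path
`z = z(s) + ∫ z'`, `z' ∈ L^∞`: `Φ(t, z(t)) − Φ(s, z(s)) = ∫ₛᵗ (φ(σ, z(σ)) + DΦ(σ, z(σ))[z'(σ)]) dσ`;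
the composite is Lipschitz, differentiable at a.e. `σ` by Lebesgue's differentiation theorem for
`z` and joint continuity of `φ`, and the vector-valued Lipschitz FTC
`sub_eq_integral_of_lipschitzOnWith_of_ae_hasDerivAt` — Mathlib's
`AbsolutelyContinuousOnInterval.const_of_ae_hasDerivAt_zero` — integrates it). The transport term
`−Dω_V[b]` so produced is exactly the drift part of `−Dω[U + b]` in (4.8). Joint continuity of
the vorticity-equation integrand comes from the Lipschitz-in-time clause for `∇ᵏV`, `k ≤ 3`
(`continuousOn_vorticityIntegrand`, through `‖Δ(Df) − Δ(Dg)‖ ≤ dim · ‖D³f − D³g‖` and the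
curry isometries `norm_iteratedFDeriv_fderiv_sub`).

## Why the Galilean covariance holds (proof plan for `IsKNSSDriftMild.GalileanCovariance`)

With `𝒩_τ = e^{τΔ}P∇·` realised by `oseenHeat`: `𝒩_τ[b⊗b] = 0` (constants), `𝒩_τ[U⊗b] = 0` and
`𝒩_τ[b⊗U] = (b·∇)e^{τΔ}U` for bounded weakly divergence-free `U` (the heat extension of such a
field is divergence free), so the drift-mild identity reads
`U(t) = e^{(t−s)Δ}U(s) − ∫ₛᵗ (𝒩_{t−σ}[U⊗U](σ) + (b(σ)·∇)e^{(t−σ)Δ}U(σ)) dσ`; restarting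
(`oseenHeat_eq_heatExtension`, `heatExtension_add`) gives, for `Φ(σ, ·) = e^{(t−σ)Δ}U(σ)`,
`Φ(σ) = Φ(s) − ∫ₛ^σ (𝒩_{t−ρ}[U⊗U](ρ) + (b(ρ)·∇)Φ(ρ)) dρ`, and along the frame path
`Ψ(σ) = Φ(σ, y + B(σ))` the transport terms cancel (`sub_eq_integral_of_path` on `[s, t']`,
`t' ↑ t`): `Ψ(t) − Ψ(s) = −∫ₛᵗ 𝒩_{t−σ}[U⊗U](σ)(y + B(σ)) dσ = −∫ₛᵗ 𝒩_{t−σ}[Ū⊗Ū](σ)(y) dσ` by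
translation covariance of `𝒩`, which is the zero-drift identity for `Ū = galileanShift U b`.

## References

* G. Koch, N. Nadirashvili, G. Seregin, V. Šverák, *Liouville theorems for the Navier–Stokes
  equations and applications*, Acta Math. 203 (2009) 83–105 = arXiv:0709.3599v1: §1 p. 3 (the
  parasitic solutions `u = b(t)`), §3 Lemma 3.1 and Remark 3.1 (p. 7), §4 (i)–(ii),
  Proposition 4.1 with (4.6), and the closing paragraph (4.7)–(4.11) (p. 8).
  [KochNadirashviliSereginSverak2009]
* A. J. Majda, A. L. Bertozzi, *Vorticity and Incompressible Flow* (CUP 2002), §1.2 (Galilean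
  invariance of the Euler and Navier–Stokes equations). [MajdaBertozziCUP2002]
-/

noncomputable section

open MeasureTheory Set Function Filter TopologicalSpace InnerProductSpace Metric
open _root_.Topology
open scoped RealInnerProductSpace Laplacian ContDiff NNReal Interval

namespace Literature.Analysis.FluidPDE

/-! ### A vector-valued fundamental theorem of calculus for Lipschitz functions -/

section FTC

variable {F : Type*} [NormedAddCommGroup F]

/-- A bounded, a.e. strongly measurable function on `ℝ` is locally integrable. [folklore] -/
theorem locallyIntegrable_of_norm_le {g : ℝ → F} (hgm : AEStronglyMeasurable g volume) {M : ℝ}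
    (hgM : ∀ x, ‖g x‖ ≤ M) : LocallyIntegrable g volume :=
  (memLp_top_of_bound hgm M (Eventually.of_forall hgM)).locallyIntegrable le_top

/-- A bounded, a.e. strongly measurable function on `ℝ` is interval integrable. [folklore] -/
theorem intervalIntegrable_of_norm_le {g : ℝ → F} (hgm : AEStronglyMeasurable g volume) {M : ℝ}
    (hgM : ∀ x, ‖g x‖ ≤ M) (a b : ℝ) : IntervalIntegrable g volume a b :=
  ((locallyIntegrable_of_norm_le hgm hgM).integrableOn_isCompact isCompact_uIcc).intervalIntegrable

/-- **FTC for Lipschitz functions with an a.e. derivative** (vector-valued): if `f` is Lipschitz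
on `[a, b]`, `g` is bounded and a.e. strongly measurable, and `f' = g` a.e. on `(a, b)`, then
`f b - f a = ∫_a^b g` (both `f` and `x ↦ ∫_a^x g` are absolutely continuous, their difference has
a.e. derivative zero, hence is constant: Mathlib's
`AbsolutelyContinuousOnInterval.const_of_ae_hasDerivAt_zero` and the Lebesgue differentiation
theorem `LocallyIntegrable.ae_hasDerivAt_integral`). [folklore] -/
theorem sub_eq_integral_of_lipschitzOnWith_of_ae_hasDerivAt [NormedSpace ℝ F] [CompleteSpace F]
    {f g : ℝ → F} {a b : ℝ} (hab : a ≤ b)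
    {K : ℝ≥0} (hf : LipschitzOnWith K f (Icc a b)) (hgm : AEStronglyMeasurable g volume)
    {M : ℝ} (hgM : ∀ x, ‖g x‖ ≤ M)
    (hderiv : ∀ᵐ x, x ∈ Ioo a b → HasDerivAt f (g x) x) :
    f b - f a = ∫ x in a..b, g x := by
  have hM0 : 0 ≤ M := (norm_nonneg _).trans (hgM a)
  have hgi : ∀ x y : ℝ, IntervalIntegrable g volume x y := intervalIntegrable_of_norm_le hgm hgM
  set G : ℝ → F := fun x => ∫ t in a..x, g t with hG
  -- `G` is Lipschitz
  have hGlip : LipschitzWith ⟨M, hM0⟩ G := by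
    refine LipschitzWith.of_dist_le_mul fun x y => ?_
    rw [dist_eq_norm, hG]
    simp only
    rw [intervalIntegral.integral_interval_sub_left (hgi a x) (hgi a y)]
    calc ‖∫ t in y..x, g t‖ ≤ M * |x - y| :=
          intervalIntegral.norm_integral_le_of_norm_le_const fun t _ => hgM t
      _ = (⟨M, hM0⟩ : ℝ≥0) * dist x y := by rw [Real.dist_eq]
  -- the difference is absolutely continuous with a.e. derivative zero
  have hφ : AbsolutelyContinuousOnInterval (fun x => f x - G x) a b := by
    refine AbsolutelyContinuousOnInterval.sub ?_ ?_
    · exact (hf.mono (by rw [uIcc_of_le hab])).absolutelyContinuousOnInterval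
    · exact (hGlip.lipschitzOnWith (s := uIcc a b)).absolutelyContinuousOnInterval
  have hG' : ∀ᵐ x, HasDerivAt G (g x) x := by
    filter_upwards [_root_.LocallyIntegrable.ae_hasDerivAt_integral
      (locallyIntegrable_of_norm_le hgm hgM)] with x hx
    exact hx a
  have hend : ∀ᵐ x : ℝ, x ≠ a ∧ x ≠ b := by
    have h1 : ∀ᵐ x : ℝ, x ≠ a := by simp [ae_iff, measure_singleton]
    have h2 : ∀ᵐ x : ℝ, x ≠ b := by simp [ae_iff, measure_singleton]
    filter_upwards [h1, h2] with x h1 h2 using ⟨h1, h2⟩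
  have hφ' : ∀ᵐ x, x ∈ uIcc a b → HasDerivAt (fun x => f x - G x) 0 x := by
    filter_upwards [hderiv, hG', hend] with x hx hGx hne hxI
    rw [uIcc_of_le hab] at hxI
    have hxo : x ∈ Ioo a b := ⟨lt_of_le_of_ne hxI.1 (Ne.symm hne.1), lt_of_le_of_ne hxI.2 hne.2⟩
    have h := (hx hxo).sub hGx
    rwa [sub_self] at h
  obtain ⟨C, hC⟩ := hφ.const_of_ae_hasDerivAt_zero hφ'
  have ha := hC a (by rw [uIcc_of_le hab]; exact left_mem_Icc.2 hab)
  have hb := hC b (by rw [uIcc_of_le hab]; exact right_mem_Icc.2 hab)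
  have hGa : G a = 0 := by simp [hG]
  rw [hGa, sub_zero] at ha
  rw [← ha] at hb
  -- `f b - G b = f a`
  have h : f b = f a + G b := by rw [← hb]; abel
  rw [h]; abel

end FTC

/-! ### The moving-frame (path) fundamental theorem of calculus -/

section PathFTC

variable {E : Type*} [NormedAddCommGroup E] [NormedSpace ℝ E] [FiniteDimensional ℝ E]
variable {F : Type*} [NormedAddCommGroup F] [NormedSpace ℝ F] [CompleteSpace F]

/-- **Chain rule along a Lipschitz path, integrated form (moving-frame FTC).** Let
`Φ σ w = Φ s w + ∫ₛ^σ φ ρ w dρ` on `[s, t] × E` with `φ` jointly continuous, every slice `Φ σ`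
differentiable and `(σ, w) ↦ D(Φ σ)(w)` jointly continuous, and let `z σ = z s + ∫ₛ^σ z'` be a
path with bounded measurable velocity `z'`. Then
`Φ t (z t) − Φ s (z s) = ∫ₛᵗ (φ σ (z σ) + D(Φ σ)(z σ)[z' σ]) dσ`.
(The composite `σ ↦ Φ σ (z σ)` is Lipschitz; at a.e. `σ` — wherever `z` is differentiable with
`z' σ`, Lebesgue's differentiation theorem — it is differentiable with the displayed derivative,
the term `∫_σ^{σ+h} φ ρ (z (σ+h)) dρ = h φ σ (z σ) + o(h)` by joint continuity; conclude by the
Lipschitz FTC `sub_eq_integral_of_lipschitzOnWith_of_ae_hasDerivAt`.) This is the calculus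
behind Galilean changes of frame `x = y + B(t)`, `B' = b ∈ L^∞`, for classical quantities. [folklore] -/
theorem sub_eq_integral_of_path {Φ φ : ℝ → E → F} {z z' : ℝ → E} {s t : ℝ} (hst : s ≤ t)
    (hΦ : ∀ σ ∈ Icc s t, ∀ w, Φ σ w = Φ s w + ∫ ρ in s..σ, φ ρ w)
    (hφ : ContinuousOn (uncurry φ) (Icc s t ×ˢ univ))
    (hΦd : ∀ σ ∈ Icc s t, Differentiable ℝ (Φ σ))
    (hDΦ : ContinuousOn (fun p : ℝ × E => fderiv ℝ (Φ p.1) p.2) (Icc s t ×ˢ univ))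
    (hz'm : AEStronglyMeasurable z' volume) {N : ℝ} (hz'N : ∀ σ, ‖z' σ‖ ≤ N)
    (hz : ∀ σ ∈ Icc s t, z σ = z s + ∫ ρ in s..σ, z' ρ) :
    Φ t (z t) - Φ s (z s) = ∫ σ in s..t, (φ σ (z σ) + fderiv ℝ (Φ σ) (z σ) (z' σ)) := by
  have hN0 : 0 ≤ N := (norm_nonneg _).trans (hz'N s)
  have hz'i : ∀ x y : ℝ, IntervalIntegrable z' volume x y := intervalIntegrable_of_norm_le hz'm hz'N
  -- the path is Lipschitz and continuous on `[s, t]`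
  have hzsub : ∀ σ₁ ∈ Icc s t, ∀ σ₂ ∈ Icc s t, z σ₂ - z σ₁ = ∫ ρ in σ₁..σ₂, z' ρ := by
    intro σ₁ h₁ σ₂ h₂
    rw [hz σ₂ h₂, hz σ₁ h₁, add_sub_add_left_eq_sub,
      intervalIntegral.integral_interval_sub_left (hz'i s σ₂) (hz'i s σ₁)]
  have hzlip : ∀ σ₁ ∈ Icc s t, ∀ σ₂ ∈ Icc s t, ‖z σ₂ - z σ₁‖ ≤ N * |σ₂ - σ₁| := by
    intro σ₁ h₁ σ₂ h₂
    rw [hzsub σ₁ h₁ σ₂ h₂]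
    exact intervalIntegral.norm_integral_le_of_norm_le_const fun ρ _ => hz'N ρ
  have hzcont : ContinuousOn z (Icc s t) := by
    have h1 : ContinuousOn (fun σ => z s + ∫ ρ in s..σ, z' ρ) (Icc s t) :=
      (continuousOn_const.add
        ((intervalIntegral.continuous_primitive (fun x y => hz'i x y) s).continuousOn))
    exact h1.congr fun σ hσ => hz σ hσ
  -- a ball containing the path, and bounds for `φ`, `DΦ` over `[s, t] × ball`
  obtain ⟨R, hR⟩ := ((isCompact_Icc.image_of_continuousOn hzcont).isBounded).subset_closedBall (0 : E)
  have hzR : ∀ σ ∈ Icc s t, z σ ∈ closedBall (0 : E) R := fun σ hσ => hR (mem_image_of_mem z hσ)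
  have hcpt : IsCompact (Icc s t ×ˢ closedBall (0 : E) R) := isCompact_Icc.prod (isCompact_closedBall 0 R)
  obtain ⟨Mφ, hMφ⟩ := hcpt.exists_bound_of_continuousOn (hφ.mono (prod_mono Subset.rfl (subset_univ _)))
  obtain ⟨MD, hMD⟩ := hcpt.exists_bound_of_continuousOn (hDΦ.mono (prod_mono Subset.rfl (subset_univ _)))
  have hMφ' : ∀ σ ∈ Icc s t, ∀ w ∈ closedBall (0 : E) R, ‖φ σ w‖ ≤ Mφ := fun σ hσ w hw =>
    hMφ (σ, w) (mk_mem_prod hσ hw)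
  have hMD' : ∀ σ ∈ Icc s t, ∀ w ∈ closedBall (0 : E) R, ‖fderiv ℝ (Φ σ) w‖ ≤ MD := fun σ hσ w hw =>
    hMD (σ, w) (mk_mem_prod hσ hw)
  have hMφ0 : 0 ≤ Mφ := (norm_nonneg _).trans (hMφ' s (left_mem_Icc.2 hst) (z s) (hzR s (left_mem_Icc.2 hst)))
  have hMD0 : 0 ≤ MD := (norm_nonneg _).trans (hMD' s (left_mem_Icc.2 hst) (z s) (hzR s (left_mem_Icc.2 hst)))
  -- interval integrability of `ρ ↦ φ ρ w` on subintervals of `[s, t]`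
  have hφi : ∀ w, ∀ σ₁ ∈ Icc s t, ∀ σ₂ ∈ Icc s t, IntervalIntegrable (fun ρ => φ ρ w) volume σ₁ σ₂ := by
    intro w σ₁ h₁ σ₂ h₂
    have hc : ContinuousOn (fun ρ => φ ρ w) (Icc s t) :=
      hφ.comp (continuousOn_id.prodMk continuousOn_const) fun ρ hρ => mk_mem_prod hρ (mem_univ w)
    exact (hc.mono (uIcc_subset_Icc h₁ h₂)).intervalIntegrable
  -- differences in time are integrals of `φ`
  have hΦsub : ∀ σ₁ ∈ Icc s t, ∀ σ₂ ∈ Icc s t, ∀ w,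
      Φ σ₂ w - Φ σ₁ w = ∫ ρ in σ₁..σ₂, φ ρ w := by
    intro σ₁ h₁ σ₂ h₂ w
    rw [hΦ σ₂ h₂ w, hΦ σ₁ h₁ w, add_sub_add_left_eq_sub,
      intervalIntegral.integral_interval_sub_left (hφi w s (left_mem_Icc.2 hst) σ₂ h₂)
        (hφi w s (left_mem_Icc.2 hst) σ₁ h₁)]
  -- the composite and its Lipschitz bound
  set Ψ : ℝ → F := fun σ => Φ σ (z σ) with hΨ
  have hΨlip : LipschitzOnWith ⟨Mφ + MD * N, by positivity⟩ Ψ (Icc s t) := by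
    refine LipschitzOnWith.of_dist_le_mul fun σ₁ h₁ σ₂ h₂ => ?_
    rw [dist_eq_norm, Real.dist_eq]
    have e : Ψ σ₁ - Ψ σ₂ = (Φ σ₁ (z σ₁) - Φ σ₂ (z σ₁)) + (Φ σ₂ (z σ₁) - Φ σ₂ (z σ₂)) := by
      simp only [hΨ]; abel
    rw [e]
    have h1 : ‖Φ σ₁ (z σ₁) - Φ σ₂ (z σ₁)‖ ≤ Mφ * |σ₁ - σ₂| := by
      rw [hΦsub σ₂ h₂ σ₁ h₁]
      refine intervalIntegral.norm_integral_le_of_norm_le_const fun ρ hρ => ?_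
      have hρI : ρ ∈ Icc s t := by
        rcases le_total σ₂ σ₁ with h | h
        · rw [uIoc_of_le h] at hρ; exact ⟨h₂.1.trans hρ.1.le, hρ.2.trans h₁.2⟩
        · rw [uIoc_of_ge h] at hρ; exact ⟨h₁.1.trans hρ.1.le, hρ.2.trans h₂.2⟩
      exact hMφ' ρ hρI (z σ₁) (hzR σ₁ h₁)
    have h2 : ‖Φ σ₂ (z σ₁) - Φ σ₂ (z σ₂)‖ ≤ MD * N * |σ₁ - σ₂| := by
      have hmv : ‖Φ σ₂ (z σ₁) - Φ σ₂ (z σ₂)‖ ≤ MD * ‖z σ₁ - z σ₂‖ :=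
        (convex_closedBall (0 : E) R).norm_image_sub_le_of_norm_fderiv_le
          (fun w _ => (hΦd σ₂ h₂) w) (fun w hw => hMD' σ₂ h₂ w hw) (hzR σ₂ h₂) (hzR σ₁ h₁)
      calc ‖Φ σ₂ (z σ₁) - Φ σ₂ (z σ₂)‖ ≤ MD * ‖z σ₁ - z σ₂‖ := hmv
        _ ≤ MD * (N * |σ₁ - σ₂|) := mul_le_mul_of_nonneg_left (hzlip σ₂ h₂ σ₁ h₁) hMD0
        _ = MD * N * |σ₁ - σ₂| := by ring
    calc ‖(Φ σ₁ (z σ₁) - Φ σ₂ (z σ₁)) + (Φ σ₂ (z σ₁) - Φ σ₂ (z σ₂))‖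
        ≤ Mφ * |σ₁ - σ₂| + MD * N * |σ₁ - σ₂| := (norm_add_le _ _).trans (add_le_add h1 h2)
      _ = ((⟨Mφ + MD * N, by positivity⟩ : ℝ≥0) : ℝ) * |σ₁ - σ₂| := by push_cast; ring
  -- the derivative of the composite at a.e. time
  have hzderiv : ∀ᵐ σ, σ ∈ Ioo s t → HasDerivAt z (z' σ) σ := by
    filter_upwards [_root_.LocallyIntegrable.ae_hasDerivAt_integral
      (locallyIntegrable_of_norm_le hz'm hz'N)] with σ hσ hσI
    have hev : z =ᶠ[𝓝 σ] fun x => z s + ∫ ρ in s..x, z' ρ :=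
      eventuallyEq_of_mem (Icc_mem_nhds hσI.1 hσI.2) fun x hx => hz x hx
    exact ((hσ s).const_add (z s)).congr_of_eventuallyEq hev
  have hderiv : ∀ᵐ σ, σ ∈ Ioo s t →
      HasDerivAt Ψ (φ σ (z σ) + fderiv ℝ (Φ σ) (z σ) (z' σ)) σ := by
    filter_upwards [hzderiv] with σ hσ hσI
    have hzσ := hσ hσI
    have hσc : σ ∈ Icc s t := Ioo_subset_Icc_self hσI
    -- near `σ`, `Ψ x = Φ σ (z x) + ∫_σ^x φ ρ (z x) dρ`
    have hev : Ψ =ᶠ[𝓝 σ] fun x => Φ σ (z x) + ∫ ρ in σ..x, φ ρ (z x) := by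
      refine eventuallyEq_of_mem (Icc_mem_nhds hσI.1 hσI.2) fun x hx => ?_
      simp only [hΨ]
      rw [← hΦsub σ hσc x hx (z x)]
      abel
    -- derivative of the first term: chain rule
    have h1 : HasDerivAt (fun x => Φ σ (z x)) (fderiv ℝ (Φ σ) (z σ) (z' σ)) σ :=
      ((hΦd σ hσc) (z σ)).hasFDerivAt.comp_hasDerivAt σ hzσ
    -- derivative of the second term: joint continuity of `φ`
    have h2 : HasDerivAt (fun x => ∫ ρ in σ..x, φ ρ (z x)) (φ σ (z σ)) σ := by
      rw [hasDerivAt_iff_isLittleO]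
      simp only [intervalIntegral.integral_same, sub_zero]
      rw [Asymptotics.isLittleO_iff]
      intro c hc
      -- continuity of `φ` at `(σ, z σ)` and of `z` at `σ`
      have hcφ : ContinuousWithinAt (uncurry φ) (Icc s t ×ˢ univ) (σ, z σ) :=
        hφ (σ, z σ) (mk_mem_prod hσc (mem_univ _))
      rw [Metric.continuousWithinAt_iff] at hcφ
      obtain ⟨δ₁, hδ₁, hφδ⟩ := hcφ c hc
      have hcz : ContinuousAt z σ := (hzcont.continuousWithinAt hσc).continuousAt (Icc_mem_nhds hσI.1 hσI.2)
      rw [Metric.continuousAt_iff] at hcz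
      obtain ⟨δ₂, hδ₂, hzδ⟩ := hcz δ₁ hδ₁
      have hI : ∀ᶠ x in 𝓝 σ, x ∈ Ioo s t := Ioo_mem_nhds hσI.1 hσI.2
      have hB : ∀ᶠ x in 𝓝 σ, dist x σ < min δ₁ δ₂ := Metric.ball_mem_nhds σ (lt_min hδ₁ hδ₂)
      filter_upwards [hI, hB] with x hxI hxB
      have hxI' : x ∈ Icc s t := Ioo_subset_Icc_self hxI
      have hx1 : dist x σ < δ₁ := hxB.trans_le (min_le_left _ _)
      have hx2 : dist x σ < δ₂ := hxB.trans_le (min_le_right _ _)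
      have hzx : dist (z x) (z σ) < δ₁ := hzδ hx2
      -- the integrand is within `c` of `φ σ (z σ)` on the interval of integration
      have hbound : ∀ ρ ∈ Ι σ x, ‖φ ρ (z x) - φ σ (z σ)‖ ≤ c := by
        intro ρ hρ
        have hρI : ρ ∈ Icc s t := by
          rcases le_total σ x with h | h
          · rw [uIoc_of_le h] at hρ; exact ⟨hσc.1.trans hρ.1.le, hρ.2.trans hxI'.2⟩
          · rw [uIoc_of_ge h] at hρ; exact ⟨hxI'.1.trans hρ.1.le, hρ.2.trans hσc.2⟩
        have hρσ : dist ρ σ < δ₁ := by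
          have : |ρ - σ| ≤ |x - σ| := by
            rcases le_total σ x with h | h
            · rw [uIoc_of_le h] at hρ
              rw [abs_of_nonneg (by linarith [hρ.1]), abs_of_nonneg (by linarith)]; linarith [hρ.2]
            · rw [uIoc_of_ge h] at hρ
              rw [abs_of_nonpos (by linarith [hρ.2]), abs_of_nonpos (by linarith)]; linarith [hρ.1]
          calc dist ρ σ = |ρ - σ| := Real.dist_eq ρ σ
            _ ≤ |x - σ| := this
            _ = dist x σ := (Real.dist_eq x σ).symm
            _ < δ₁ := hx1
        have hd : dist (ρ, z x) (σ, z σ) < δ₁ := by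
          rw [Prod.dist_eq]; exact max_lt hρσ hzx
        have := hφδ (mk_mem_prod hρI (mem_univ _)) hd
        rw [dist_eq_norm] at this
        exact this.le
      have hint : IntervalIntegrable (fun ρ => φ ρ (z x)) volume σ x := hφi (z x) σ hσc x hxI'
      have e : (∫ ρ in σ..x, φ ρ (z x)) - (x - σ) • φ σ (z σ) =
          ∫ ρ in σ..x, (φ ρ (z x) - φ σ (z σ)) := by
        rw [intervalIntegral.integral_sub hint intervalIntegrable_const, intervalIntegral.integral_const]
      rw [e]
      calc ‖∫ ρ in σ..x, (φ ρ (z x) - φ σ (z σ))‖ ≤ c * |x - σ| :=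
            intervalIntegral.norm_integral_le_of_norm_le_const hbound
        _ = c * ‖x - σ‖ := by rw [Real.norm_eq_abs]
    have h12 := (h1.add h2).congr_of_eventuallyEq hev
    rwa [add_comm] at h12
  -- the integrand, truncated to `(s, t)`, is bounded and measurable
  set g : ℝ → F := fun σ => φ σ (z σ) + fderiv ℝ (Φ σ) (z σ) (z' σ) with hg
  set g₁ : ℝ → F := (Ioo s t).indicator g with hg₁
  have hg₁m : AEStronglyMeasurable g₁ volume := by
    rw [hg₁, aestronglyMeasurable_indicator_iff measurableSet_Ioo]
    have hA : ContinuousOn (fun σ => fderiv ℝ (Φ σ) (z σ)) (Icc s t) :=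
      hDΦ.comp (continuousOn_id.prodMk hzcont) fun σ hσ => mk_mem_prod hσ (mem_univ _)
    have hφz : ContinuousOn (fun σ => φ σ (z σ)) (Icc s t) :=
      hφ.comp (continuousOn_id.prodMk hzcont) fun σ hσ => mk_mem_prod hσ (mem_univ _)
    have h1 : AEStronglyMeasurable (fun σ => φ σ (z σ)) (volume.restrict (Ioo s t)) :=
      (hφz.mono Ioo_subset_Icc_self).aestronglyMeasurable measurableSet_Ioo
    have h2 : AEStronglyMeasurable (fun σ => fderiv ℝ (Φ σ) (z σ)) (volume.restrict (Ioo s t)) :=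
      (hA.mono Ioo_subset_Icc_self).aestronglyMeasurable measurableSet_Ioo
    have h3 : AEStronglyMeasurable (fun σ => fderiv ℝ (Φ σ) (z σ) (z' σ)) (volume.restrict (Ioo s t)) := by
      have hpair := h2.prodMk hz'm.restrict
      exact (isBoundedBilinearMap_apply.continuous).comp_aestronglyMeasurable hpair
    exact h1.add h3
  have hg₁M : ∀ σ, ‖g₁ σ‖ ≤ Mφ + MD * N := by
    intro σ
    by_cases hσ : σ ∈ Ioo s t
    · rw [hg₁, indicator_of_mem hσ, hg]
      have hσc : σ ∈ Icc s t := Ioo_subset_Icc_self hσ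
      refine (norm_add_le _ _).trans (add_le_add (hMφ' σ hσc (z σ) (hzR σ hσc)) ?_)
      calc ‖fderiv ℝ (Φ σ) (z σ) (z' σ)‖ ≤ ‖fderiv ℝ (Φ σ) (z σ)‖ * ‖z' σ‖ :=
            ContinuousLinearMap.le_opNorm _ _
        _ ≤ MD * N := mul_le_mul (hMD' σ hσc (z σ) (hzR σ hσc)) (hz'N σ) (norm_nonneg _) hMD0
    · rw [hg₁, indicator_of_notMem hσ, norm_zero]; positivity
  have hderiv₁ : ∀ᵐ σ, σ ∈ Ioo s t → HasDerivAt Ψ (g₁ σ) σ := by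
    filter_upwards [hderiv] with σ hσ hσI
    rw [hg₁, indicator_of_mem hσI]
    exact hσ hσI
  have key := sub_eq_integral_of_lipschitzOnWith_of_ae_hasDerivAt hst hΨlip hg₁m hg₁M hderiv₁
  -- `∫ g₁ = ∫ g` on `[s, t]`
  have hgg : ∫ σ in s..t, g₁ σ = ∫ σ in s..t, g σ := by
    refine intervalIntegral.integral_congr_ae ?_
    have ht : ∀ᵐ σ : ℝ, σ ≠ t := by simp [ae_iff, measure_singleton]
    filter_upwards [ht] with σ hσt hσ
    rw [uIoc_of_le hst] at hσ
    rw [hg₁, indicator_of_mem (show σ ∈ Ioo s t from ⟨hσ.1, lt_of_le_of_ne hσ.2 hσt⟩)]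
  rw [← hgg, ← key]

end PathFTC

/-! ### Norms of differences of iterated derivatives, joint continuity, translations -/

section Calculus

variable {E : Type*} [NormedAddCommGroup E] [NormedSpace ℝ E]
variable {F : Type*} [NormedAddCommGroup F] [NormedSpace ℝ F]

/-- `‖Df(x) − Dg(x)‖ = ‖D¹f(x) − D¹g(x)‖` (from the order-`0` and currying isometries of
`KNSSRegularityGluing`). [folklore] -/
theorem norm_fderiv_sub_eq_norm_iteratedFDeriv_one_sub (f g : E → F) (x : E) :
    ‖fderiv ℝ f x - fderiv ℝ g x‖ = ‖iteratedFDeriv ℝ 1 f x - iteratedFDeriv ℝ 1 g x‖ := by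
  rw [norm_sub_eq_norm_iteratedFDeriv_zero_sub, norm_iteratedFDeriv_fderiv_sub]

/-- `‖D(Df)(x) − D(Dg)(x)‖ = ‖D²f(x) − D²g(x)‖`. [folklore] -/
theorem norm_fderiv_fderiv_sub_eq (f g : E → F) (x : E) :
    ‖fderiv ℝ (fderiv ℝ f) x - fderiv ℝ (fderiv ℝ g) x‖ =
      ‖iteratedFDeriv ℝ 2 f x - iteratedFDeriv ℝ 2 g x‖ := by
  rw [norm_fderiv_sub_eq_norm_iteratedFDeriv_one_sub, norm_iteratedFDeriv_fderiv_sub]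

omit [NormedSpace ℝ E] in
/-- **Joint continuity from continuity in space and a uniform Lipschitz bound in time.** If
every slice `f τ`, `τ ∈ S`, is continuous and `‖f τ z − f τ' z‖ ≤ L |τ − τ'|` for
`τ, τ' ∈ S` uniformly in `z`, then `uncurry f` is continuous on `S × univ`. [folklore] -/
theorem continuousOn_uncurry_of_lipschitz_time {G : Type*} [NormedAddCommGroup G]
    {f : ℝ → E → G} {S : Set ℝ} (hcont : ∀ τ ∈ S, Continuous (f τ)) {L : ℝ}
    (hlip : ∀ τ ∈ S, ∀ τ' ∈ S, ∀ z, ‖f τ z - f τ' z‖ ≤ L * |τ - τ'|) :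
    ContinuousOn (uncurry f) (S ×ˢ univ) := by
  rintro ⟨τ₀, z₀⟩ hp
  have hτ₀ : τ₀ ∈ S := (mem_prod.1 hp).1
  rw [Metric.continuousWithinAt_iff]
  intro ε hε
  have hc := (hcont τ₀ hτ₀).continuousAt (x := z₀)
  rw [Metric.continuousAt_iff] at hc
  obtain ⟨δ₁, hδ₁, hz⟩ := hc (ε / 2) (half_pos hε)
  refine ⟨min δ₁ (ε / (2 * (|L| + 1))), lt_min hδ₁ (by positivity), ?_⟩
  rintro ⟨τ, z⟩ hq hd
  have hτ : τ ∈ S := (mem_prod.1 hq).1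
  rw [Prod.dist_eq, max_lt_iff] at hd
  obtain ⟨hdτ, hdz⟩ := hd
  have h1 : ‖f τ z - f τ₀ z‖ ≤ L * |τ - τ₀| := hlip τ hτ τ₀ hτ₀ z
  have h2 : dist (f τ₀ z) (f τ₀ z₀) < ε / 2 := hz (hdz.trans_le (min_le_left _ _))
  have hdτ' : |τ - τ₀| < ε / (2 * (|L| + 1)) := by
    rw [← Real.dist_eq]; exact hdτ.trans_le (min_le_right _ _)
  have h1' : ‖f τ z - f τ₀ z‖ < ε / 2 := by
    calc ‖f τ z - f τ₀ z‖ ≤ L * |τ - τ₀| := h1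
      _ ≤ |L| * |τ - τ₀| := mul_le_mul_of_nonneg_right (le_abs_self L) (abs_nonneg _)
      _ ≤ |L| * (ε / (2 * (|L| + 1))) := mul_le_mul_of_nonneg_left hdτ'.le (abs_nonneg _)
      _ < ε / 2 := by
          rw [mul_div_assoc']
          rw [div_lt_div_iff₀ (by positivity) (by positivity)]
          nlinarith [abs_nonneg L]
  calc dist (uncurry f (τ, z)) (uncurry f (τ₀, z₀))
      = ‖f τ z - f τ₀ z₀‖ := dist_eq_norm _ _
    _ ≤ ‖f τ z - f τ₀ z‖ + ‖f τ₀ z - f τ₀ z₀‖ := norm_sub_le_norm_sub_add_norm_sub _ _ _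
    _ < ε / 2 + ε / 2 := add_lt_add h1' (by rwa [dist_eq_norm] at h2)
    _ = ε := add_halves ε

/-- Translation of the Fréchet derivative: `D(f(· − a))(x) = Df(x − a)`. [folklore] -/
theorem fderiv_comp_sub_right (f : E → F) (a x : E) :
    fderiv ℝ (fun y => f (y - a)) x = fderiv ℝ f (x - a) := by
  simpa [sub_eq_add_neg] using fderiv_comp_add_right (f := f) (x := x) (-a)

/-- Translation of iterated derivatives: `Dⁿ(f(· − a))(x) = Dⁿf(x − a)`. [folklore] -/
theorem iteratedFDeriv_comp_sub_right (n : ℕ) (f : E → F) (a x : E) :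
    iteratedFDeriv ℝ n (fun y => f (y - a)) x = iteratedFDeriv ℝ n f (x - a) := by
  simpa [sub_eq_add_neg] using iteratedFDeriv_comp_add_right (f := f) n (-a) x

end Calculus

section CalculusInner

variable {E : Type*} [NormedAddCommGroup E] [InnerProductSpace ℝ E] [FiniteDimensional ℝ E]
variable {F : Type*} [NormedAddCommGroup F] [NormedSpace ℝ F]

/-- Translation of the Laplacian: `Δ(f(· − a))(x) = Δf(x − a)`. [folklore] -/
theorem laplacian_comp_sub_right (f : E → F) (a x : E) :
    (Δ (fun y => f (y - a))) x = (Δ f) (x - a) := by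
  rw [laplacian_eq_iteratedFDeriv_stdOrthonormalBasis, laplacian_eq_iteratedFDeriv_stdOrthonormalBasis]
  simp only [iteratedFDeriv_comp_sub_right]

omit [FiniteDimensional ℝ E] in
/-- Translation of the divergence: `div(f(· − a))(x) = div f(x − a)`. [folklore] -/
theorem divergence_comp_sub_right (f : E → E) (a x : E) :
    VectorCalculus.divergence (fun y => f (y - a)) x = VectorCalculus.divergence f (x - a) := by
  simp only [VectorCalculus.divergence, fderiv_comp_sub_right]

/-- `‖Δ(Df)(x) − Δ(Dg)(x)‖ ≤ dim E · ‖D³f(x) − D³g(x)‖` (the Laplacian is a sum of `dim E`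
evaluations of the second derivative at unit vectors). [folklore] -/
theorem norm_laplacian_fderiv_sub_le (f g : E → F) (x : E) :
    ‖(Δ (fderiv ℝ f)) x - (Δ (fderiv ℝ g)) x‖ ≤
      Module.finrank ℝ E * ‖iteratedFDeriv ℝ 3 f x - iteratedFDeriv ℝ 3 g x‖ := by
  rw [laplacian_eq_iteratedFDeriv_stdOrthonormalBasis, laplacian_eq_iteratedFDeriv_stdOrthonormalBasis]
  simp only
  rw [← Finset.sum_sub_distrib]
  have hb : ∀ i, ‖(iteratedFDeriv ℝ 2 (fderiv ℝ f) x - iteratedFDeriv ℝ 2 (fderiv ℝ g) x)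
      ![stdOrthonormalBasis ℝ E i, stdOrthonormalBasis ℝ E i]‖ ≤
      ‖iteratedFDeriv ℝ 3 f x - iteratedFDeriv ℝ 3 g x‖ := by
    intro i
    refine (ContinuousMultilinearMap.le_opNorm _ _).trans ?_
    rw [norm_iteratedFDeriv_fderiv_sub]
    have hprod : ∏ j, ‖(![stdOrthonormalBasis ℝ E i, stdOrthonormalBasis ℝ E i] : Fin 2 → E) j‖ = 1 := by
      simp [Fin.prod_univ_two, (stdOrthonormalBasis ℝ E).orthonormal.1 i]
    rw [hprod, mul_one]
  calc ‖∑ i, (iteratedFDeriv ℝ 2 (fderiv ℝ f) x ![stdOrthonormalBasis ℝ E i, stdOrthonormalBasis ℝ E i] -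
          iteratedFDeriv ℝ 2 (fderiv ℝ g) x ![stdOrthonormalBasis ℝ E i, stdOrthonormalBasis ℝ E i])‖
      ≤ ∑ i, ‖(iteratedFDeriv ℝ 2 (fderiv ℝ f) x - iteratedFDeriv ℝ 2 (fderiv ℝ g) x)
          ![stdOrthonormalBasis ℝ E i, stdOrthonormalBasis ℝ E i]‖ := by
        exact norm_sum_le_of_le _ fun i _ => le_of_eq rfl
    _ ≤ ∑ _i : Fin (Module.finrank ℝ E), ‖iteratedFDeriv ℝ 3 f x - iteratedFDeriv ℝ 3 g x‖ :=
        Finset.sum_le_sum fun i _ => hb i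
    _ = Module.finrank ℝ E * ‖iteratedFDeriv ℝ 3 f x - iteratedFDeriv ℝ 3 g x‖ := by
        rw [Finset.sum_const, Finset.card_univ, Fintype.card_fin, nsmul_eq_mul]

/-- The Laplacian of a `C²` function is continuous (sum of evaluations of the continuous second
derivative). [folklore] -/
theorem continuous_laplacian_of_contDiff {f : E → F} (hf : ContDiff ℝ 2 f) : Continuous (Δ f) := by
  rw [laplacian_eq_iteratedFDeriv_stdOrthonormalBasis]
  refine continuous_finsetSum _ fun i _ => ?_
  exact (hf.continuous_iteratedFDeriv le_rfl).eval_const _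

end CalculusInner

/-! ### The frame path of a drift and the Galilean transform -/

section Galilean

variable {E : Type*} [NormedAddCommGroup E] [NormedSpace ℝ E]

/-- **The frame path of a drift**: `driftPath b t = B(t) = ∫₀ᵗ b(τ) dτ`, the position at time `t`
of the frame moving with the (bounded measurable, `x`-independent) velocity `b` (KNSS 2009, §1
p. 3: the parasitic solutions `u(x, t) = b(t)`; the co-moving frame is `y = x − B(t)`). Interval
integral; for bounded measurable `b` it is Lipschitz with `B(t) − B(s) = ∫ₛᵗ b`. [cite: KochNadirashviliSereginSverak2009, §1 p. 3 (arXiv:0709.3599v1)] -/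
def driftPath (b : ℝ → E) (t : ℝ) : E :=
  ∫ τ in (0 : ℝ)..t, b τ

/-- **The Galilean transform of a velocity field by a drift** (passage to the frame co-moving
with `B = driftPath b`, *without* velocity shift): `galileanShift U b t y = U t (y + B t)`. For a
drift-mild pair `(U, b)` (`IsKNSSDriftMild`; full velocity `u = U + b`) this is the classical
Galilean transform `u(y + B(t), t) − B'(t)` of `u` (KNSS 2009, §1 p. 3; Majda–Bertozzi 2002,
§1.2, Galilean invariance). [cite: KochNadirashviliSereginSverak2009, §1 p. 3 (arXiv:0709.3599v1)] -/
def galileanShift (U : ℝ → E → E) (b : ℝ → E) (t : ℝ) (y : E) : E :=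
  U t (y + driftPath b t)

/-- Unfolding `galileanShift`. [folklore] -/
@[simp]
theorem galileanShift_apply (U : ℝ → E → E) (b : ℝ → E) (t : ℝ) (y : E) :
    galileanShift U b t y = U t (y + driftPath b t) :=
  rfl

/-- Back to the fixed frame: `U t x = (galileanShift U b) t (x − B t)`. [folklore] -/
theorem galileanShift_sub_driftPath (U : ℝ → E → E) (b : ℝ → E) (t : ℝ) (x : E) :
    galileanShift U b t (x - driftPath b t) = U t x := by
  simp [galileanShift]

/-- `B(0) = 0`. [folklore] -/
@[simp]
theorem driftPath_zero (b : ℝ → E) : driftPath b 0 = 0 := by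
  simp [driftPath]

variable {b : ℝ → E} {N : ℝ}

/-- `B(t) − B(s) = ∫ₛᵗ b` for a bounded measurable drift. [folklore] -/
theorem driftPath_sub (hbm : AEStronglyMeasurable b volume) (hbN : ∀ t, ‖b t‖ ≤ N) (s t : ℝ) :
    driftPath b t - driftPath b s = ∫ τ in s..t, b τ := by
  have hi : ∀ x y : ℝ, IntervalIntegrable b volume x y :=
    intervalIntegrable_of_norm_le hbm hbN
  rw [driftPath, driftPath, intervalIntegral.integral_interval_sub_left (hi 0 t) (hi 0 s)]

/-- `B(t) = B(s) + ∫ₛᵗ b` for a bounded measurable drift. [folklore] -/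
theorem driftPath_eq_add (hbm : AEStronglyMeasurable b volume) (hbN : ∀ t, ‖b t‖ ≤ N) (s t : ℝ) :
    driftPath b t = driftPath b s + ∫ τ in s..t, b τ := by
  rw [← driftPath_sub hbm hbN s t, add_sub_cancel]

/-- The frame path of a drift bounded by `N` is `N`-Lipschitz: `‖B(t) − B(s)‖ ≤ N |t − s|`.
[folklore] -/
theorem norm_driftPath_sub_le (hbm : AEStronglyMeasurable b volume) (hbN : ∀ t, ‖b t‖ ≤ N) (s t : ℝ) :
    ‖driftPath b t - driftPath b s‖ ≤ N * |t - s| := by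
  rw [driftPath_sub hbm hbN s t]
  exact intervalIntegral.norm_integral_le_of_norm_le_const fun τ _ => hbN τ

/-- The frame path of a bounded measurable drift is continuous. [folklore] -/
theorem continuous_driftPath (hbm : AEStronglyMeasurable b volume) (hbN : ∀ t, ‖b t‖ ≤ N) :
    Continuous (driftPath b) :=
  intervalIntegral.continuous_primitive
    (fun x y => intervalIntegrable_of_norm_le hbm hbN x y) 0

end Galilean

/-! ### The named facts: Galilean covariance of the drift-mild class; regularity of bounded
mild solutions -/

section Facts

/-- **Galilean covariance of KNSS's drift-mild formulation** (the mild-formulation rendering of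
the Galilean invariance of the Navier–Stokes equations under time-dependent translations
`x = y + B(t)`, `u ↦ u − B'(t)`, `p ↦ p + B''·y`; Majda–Bertozzi 2002, §1.2 (Galilean
invariance); for KNSS 2009 the velocity shift is exactly the parasitic part: `u = U + b(t)`,
§1 p. 3, Lemma 3.1 and Remark 3.1). **Statement.** If `(U, b)` is drift-mild on `(0, T)` with
bound `N` (`IsKNSSDriftMild T N U b`: `U(t) = e^{(t−s)Δ}U(s) − ∫ₛᵗ e^{(t−σ)Δ}P∇·((U+b)⊗(U+b)) dσ`
pointwise, `0 < s < t < T`), then the co-moving field `Ū(t, y) = U(t, y + B(t))`,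
`B(t) = ∫₀ᵗ b`, is drift-mild with **zero drift** and the same bound:
`Ū(t) = e^{(t−s)Δ}Ū(s) − ∫ₛᵗ e^{(t−σ)Δ}P∇·(Ū ⊗ Ū) dσ`, i.e. `Ū` is a bounded mild solution of
Navier–Stokes in the sense of KNSS §4 (i). (Formally: `U_t = ΔU − P∇·(U⊗U) − (b·∇)U`, since
`e^{τΔ}P∇·` kills `b⊗b` and `U⊗b` (`div U = 0`) and maps `b⊗U` to `(b·∇)e^{τΔ}U`; the substitution
`y = x − B(t)` removes the transport term. Proof plan at the level of the identities: with
`Φ(σ, z) = (e^{(t−σ)Δ}U(σ))(z)`, the restarted identity gives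
`∂_σΦ = −e^{(t−σ)Δ}P∇·(U⊗U)(σ) − (b(σ)·∇)Φ(σ, ·)`, so along the frame path
`Ψ(σ) = Φ(σ, y + B(σ))` the drift terms cancel, `Ψ'(σ) = −(e^{(t−σ)Δ}P∇·(U⊗U)(σ))(y + B(σ))
= −(e^{(t−σ)Δ}P∇·(Ū⊗Ū)(σ))(y)`, and `Ψ(t) − Ψ(s)` is the zero-drift identity; the calculus step
is `sub_eq_integral_of_path`.) Not a printed statement: recorded as a named proposition so that
the reduction `KNSS2009_driftMild_regularity_of_mild` can be stated; to be proved in a sibling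
file from the `oseenHeat` calculus (`OseenHeatSemigroup`, `OseenHeatCommute`). [folklore] -/
def IsKNSSDriftMild.GalileanCovariance (E : Type*) [NormedAddCommGroup E] [InnerProductSpace ℝ E]
    [FiniteDimensional ℝ E] [MeasurableSpace E] [BorelSpace E] : Prop :=
  ∀ ⦃T N : ℝ⦄ ⦃U : ℝ → E → E⦄ ⦃b : ℝ → E⦄,
    IsKNSSDriftMild T N U b → IsKNSSDriftMild T N (galileanShift U b) 0

/-- **KNSS 2009, §4: regularity of bounded mild solutions on a window** — the case `b ≡ 0` of
`KNSS2009_driftMild_regularity` (Acta Math. 203 (2009) = arXiv:0709.3599v1, §4: Proposition 4.1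
"Let `u ∈ L^∞_{x,t}(ℝⁿ × (0,T))` be a mild solution of (4.1), (4.2) with `u₀ ∈ L^∞`. Then for
`k, l = 0, 1, …` the functions `t^{k/2+l}∇ᵏₓ∂ₜˡu` are bounded and, for
`T' = ε(k,l)‖u₀‖^{-2}_{L^∞}`, (4.6) `‖t^{k/2+l}∇ᵏₓ∂ₜˡu‖_{L^∞(ℝⁿ×(0,T'))} ≤ C(k,l)‖u₀‖_{L^∞}`";
and the closing paragraph, (4.8)–(4.11), for `u = v + w + b` with `b` constant, i.e. for
bounded mild solutions: (4.10) `‖∇ᵏₓu‖_{L^∞(ℝⁿ×(δ,T))} ≤ C(k,δ,T,M)`, (4.11)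
`‖∇ᵏₓ∂ₜu‖_{L^∞(ℝⁿ×(δ,T))} ≤ C`, and the vorticity equation (4.8)). **Statement** (`n = 3`,
`ν = 1`; the rendering of `KNSS2009_driftMild_regularity` specialised to zero drift). For all
`N` and `T > 0` there are constants `C(k, δ), L(k, δ)` such that every `V` with
`IsKNSSDriftMild T N V 0` — a jointly measurable field bounded by `N` on `(0, T) × ℝ³`, weakly
divergence free at a.e. time, with `V(t) = e^{(t−s)Δ}V(s) − ∫ₛᵗ e^{(t−σ)Δ}P∇·(V⊗V)(σ) dσ`
pointwise for `0 < s < t < T` (KNSS §4 (i): a bounded mild solution, restarted at every `s`) —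
has `C^∞` divergence-free slices `V(t, ·)`, `0 < t < T`, with
`‖∇ᵏₓV(t, x)‖ ≤ C(k, δ)` and `‖∇ᵏₓV(t, x) − ∇ᵏₓV(s, x)‖ ≤ L(k, δ)|t − s|` on `ℝ³ × (δ, T)`, and
`ω = curl V` satisfies `ω(t,x) − ω(s,x) = ∫ₛᵗ (Δω − Dω[V] + DV[ω])(τ, x) dτ` for all `x` and
`0 < s ≤ t < T`. Uniformity of the constants in `V` (given `N`, `T`) is (4.6) applied on the
windows `(t − h, t)`, `h = min(δ, ε M⁻²)/2`. [cite: KochNadirashviliSereginSverak2009, Prop. 4.1 with (4.6) and §4 (4.8)–(4.11) (arXiv:0709.3599v1 p. 8)] -/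
def KNSS2009_mild_regularity : Prop :=
  ∀ N T : ℝ, 0 < T →
    ∃ (C L : ℕ → ℝ → ℝ),
      ∀ ⦃V : ℝ → EuclideanSpace ℝ (Fin 3) → EuclideanSpace ℝ (Fin 3)⦄,
        IsKNSSDriftMild T N V 0 →
        (∀ t ∈ Ioo 0 T, ContDiff ℝ ∞ (V t)) ∧
        (∀ t ∈ Ioo 0 T, VectorCalculus.IsDivFree (V t)) ∧
        (∀ δ : ℝ, 0 < δ → ∀ k : ℕ, ∀ t ∈ Ioo δ T, ∀ x,
          ‖iteratedFDeriv ℝ k (V t) x‖ ≤ C k δ) ∧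
        (∀ δ : ℝ, 0 < δ → ∀ k : ℕ, ∀ s ∈ Ioo δ T, ∀ t ∈ Ioo δ T, ∀ x,
          ‖iteratedFDeriv ℝ k (V t) x - iteratedFDeriv ℝ k (V s) x‖ ≤ L k δ * |t - s|) ∧
        (∀ x, ∀ s t : ℝ, 0 < s → s ≤ t → t < T →
          curl (V t) x - curl (V s) x =
            ∫ τ in s..t, ((Δ (curl (V τ))) x - fderiv ℝ (curl (V τ)) x (V τ x) +
              fderiv ℝ (V τ) x (curl (V τ) x)))

/-- The zero-drift case of `KNSS2009_driftMild_regularity` is `KNSS2009_mild_regularity`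
(specialisation `b = 0`). [cite: KochNadirashviliSereginSverak2009, §4 (4.8)–(4.11) (arXiv:0709.3599v1 p. 8)] -/
theorem KNSS2009_mild_regularity_of_driftMild (h : KNSS2009_driftMild_regularity) :
    KNSS2009_mild_regularity := by
  intro N T hT
  obtain ⟨C, L, hCL⟩ := h N T hT
  refine ⟨C, L, fun V hV => ?_⟩
  obtain ⟨h1, h2, h3, h4, h5⟩ := hCL hV
  refine ⟨h1, h2, h3, h4, fun x s t hs hst ht => ?_⟩
  simpa using h5 x s t hs hst ht

end Facts

/-! ### Joint continuity of the derivatives of a field with Lipschitz-in-time `x`-derivatives -/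

section JointContinuity

variable {E : Type*} [NormedAddCommGroup E] [InnerProductSpace ℝ E] [FiniteDimensional ℝ E]

/-- For a field with `C^∞` slices on an open time set `S` whose iterated `x`-derivatives of
orders `0, …, 3` are Lipschitz in time uniformly in `x`, the slices, their first and second
derivatives and the Laplacian of the first derivative are jointly continuous on `S × E`.
[folklore] -/
theorem continuousOn_derivatives_of_lipschitz_time {V : ℝ → E → E} {S : Set ℝ}
    (h1 : ∀ τ ∈ S, ContDiff ℝ ∞ (V τ)) {L : ℕ → ℝ}
    (h4 : ∀ k : ℕ, ∀ τ ∈ S, ∀ τ' ∈ S, ∀ x,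
      ‖iteratedFDeriv ℝ k (V τ) x - iteratedFDeriv ℝ k (V τ') x‖ ≤ L k * |τ - τ'|) :
    ContinuousOn (uncurry V) (S ×ˢ univ) ∧
    ContinuousOn (fun p : ℝ × E => fderiv ℝ (V p.1) p.2) (S ×ˢ univ) ∧
    ContinuousOn (fun p : ℝ × E => fderiv ℝ (fderiv ℝ (V p.1)) p.2) (S ×ˢ univ) ∧
    ContinuousOn (fun p : ℝ × E => (Δ (fderiv ℝ (V p.1))) p.2) (S ×ˢ univ) := by
  have hsm : ∀ τ ∈ S, ContDiff ℝ ∞ (fderiv ℝ (V τ)) := fun τ hτ =>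
    (h1 τ hτ).fderiv_right (m := ∞) (by exact_mod_cast le_top)
  refine ⟨?_, ?_, ?_, ?_⟩
  · refine continuousOn_uncurry_of_lipschitz_time (fun τ hτ => (h1 τ hτ).continuous) (L := L 0)
      fun τ hτ τ' hτ' z => ?_
    rw [norm_sub_eq_norm_iteratedFDeriv_zero_sub]
    exact h4 0 τ hτ τ' hτ' z
  · refine continuousOn_uncurry_of_lipschitz_time (f := fun τ z => fderiv ℝ (V τ) z)
      (fun τ hτ => (h1 τ hτ).continuous_fderiv (by simp)) (L := L 1)
      fun τ hτ τ' hτ' z => ?_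
    rw [norm_fderiv_sub_eq_norm_iteratedFDeriv_one_sub]
    exact h4 1 τ hτ τ' hτ' z
  · refine continuousOn_uncurry_of_lipschitz_time (f := fun τ z => fderiv ℝ (fderiv ℝ (V τ)) z)
      (fun τ hτ => (hsm τ hτ).continuous_fderiv (by simp)) (L := L 2)
      fun τ hτ τ' hτ' z => ?_
    rw [norm_fderiv_fderiv_sub_eq]
    exact h4 2 τ hτ τ' hτ' z
  · refine continuousOn_uncurry_of_lipschitz_time (f := fun τ z => (Δ (fderiv ℝ (V τ))) z)
      (fun τ hτ => continuous_laplacian_of_contDiff (contDiff_infty.1 (hsm τ hτ) 2))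
      (L := Module.finrank ℝ E * L 3) fun τ hτ τ' hτ' z => ?_
    calc ‖(Δ (fderiv ℝ (V τ))) z - (Δ (fderiv ℝ (V τ'))) z‖
        ≤ Module.finrank ℝ E * ‖iteratedFDeriv ℝ 3 (V τ) z - iteratedFDeriv ℝ 3 (V τ') z‖ :=
          norm_laplacian_fderiv_sub_le _ _ _
      _ ≤ Module.finrank ℝ E * (L 3 * |τ - τ'|) :=
          mul_le_mul_of_nonneg_left (h4 3 τ hτ τ' hτ' z) (Nat.cast_nonneg _)
      _ = Module.finrank ℝ E * L 3 * |τ - τ'| := by ring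

end JointContinuity

section VorticityIntegrand

/-- `Δ(curl v)(z) = curlCLM (Δ(Dv)(z))` for a `C³` field on `ℝ³`. [folklore] -/
theorem laplacian_curl_eq {v : EuclideanSpace ℝ (Fin 3) → EuclideanSpace ℝ (Fin 3)}
    (hv : ContDiff ℝ 3 v) (z : EuclideanSpace ℝ (Fin 3)) :
    (Δ (curl v)) z = curlCLM ((Δ (fderiv ℝ v)) z) := by
  rw [curl_eq_curlCLM_comp]
  have h2 : ContDiffAt ℝ 2 (fderiv ℝ v) z :=
    (hv.fderiv_right (m := 2) (by norm_num)).contDiffAt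
  rw [h2.laplacian_CLM_comp_left]
  rfl

/-- **Joint continuity of the vorticity-equation integrand.** For a field `V` on `ℝ³` with
`C^∞` slices on a time set `S` and iterated `x`-derivatives of orders `≤ 3` Lipschitz in
time uniformly in `x`, the maps `(τ, z) ↦ D(curl V τ)(z)` and
`(τ, z) ↦ Δ(curl V τ)(z) − D(curl V τ)(z)[V τ z] + D(V τ)(z)[curl V τ z]` are jointly
continuous on `S × ℝ³`. [folklore] -/
theorem continuousOn_vorticityIntegrand
    {V : ℝ → EuclideanSpace ℝ (Fin 3) → EuclideanSpace ℝ (Fin 3)} {S : Set ℝ}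
    (h1 : ∀ τ ∈ S, ContDiff ℝ ∞ (V τ)) {L : ℕ → ℝ}
    (h4 : ∀ k : ℕ, ∀ τ ∈ S, ∀ τ' ∈ S, ∀ x,
      ‖iteratedFDeriv ℝ k (V τ) x - iteratedFDeriv ℝ k (V τ') x‖ ≤ L k * |τ - τ'|) :
    ContinuousOn (fun p : ℝ × EuclideanSpace ℝ (Fin 3) => fderiv ℝ (curl (V p.1)) p.2)
      (S ×ˢ univ) ∧
    ContinuousOn (uncurry fun τ z => (Δ (curl (V τ))) z - fderiv ℝ (curl (V τ)) z (V τ z) +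
      fderiv ℝ (V τ) z (curl (V τ) z)) (S ×ˢ univ) := by
  obtain ⟨c0, c1, c2, c3⟩ := continuousOn_derivatives_of_lipschitz_time h1 h4
  have h2' : ∀ τ ∈ S, ContDiff ℝ 2 (V τ) := fun τ hτ => contDiff_infty.1 (h1 τ hτ) 2
  have h3' : ∀ τ ∈ S, ContDiff ℝ 3 (V τ) := fun τ hτ => contDiff_infty.1 (h1 τ hτ) 3
  -- `D(curl V τ)(z) = curlCLM ∘ D²(V τ)(z)`
  have hDcurl : ContinuousOn
      (fun p : ℝ × EuclideanSpace ℝ (Fin 3) => fderiv ℝ (curl (V p.1)) p.2) (S ×ˢ univ) := by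
    have hL : Continuous fun A : EuclideanSpace ℝ (Fin 3) →L[ℝ]
        (EuclideanSpace ℝ (Fin 3) →L[ℝ] EuclideanSpace ℝ (Fin 3)) => curlCLM.comp A :=
      (ContinuousLinearMap.compL ℝ (EuclideanSpace ℝ (Fin 3))
        (EuclideanSpace ℝ (Fin 3) →L[ℝ] EuclideanSpace ℝ (Fin 3)) (EuclideanSpace ℝ (Fin 3))
        curlCLM).continuous
    refine (hL.comp_continuousOn c2).congr fun p hp => ?_
    exact fderiv_curl (h2' p.1 (mem_prod.1 hp).1) p.2
  refine ⟨hDcurl, ?_⟩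
  -- `curl V τ z = curlCLM (D(V τ)(z))`
  have hcurlc : ContinuousOn
      (fun p : ℝ × EuclideanSpace ℝ (Fin 3) => curl (V p.1) p.2) (S ×ˢ univ) :=
    (curlCLM.continuous.comp_continuousOn c1).congr fun p _ => curl_eq_curlCLM _ _
  -- `Δ(curl V τ)(z) = curlCLM (Δ(D(V τ))(z))`
  have hlap : ContinuousOn
      (fun p : ℝ × EuclideanSpace ℝ (Fin 3) => (Δ (curl (V p.1))) p.2) (S ×ˢ univ) :=
    (curlCLM.continuous.comp_continuousOn c3).congr fun p hp =>
      laplacian_curl_eq (h3' p.1 (mem_prod.1 hp).1) p.2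
  exact (hlap.sub (hDcurl.clm_apply c0)).add (c1.clm_apply hcurlc)

end VorticityIntegrand

/-! ### The reduction: drift-mild regularity from mild regularity and Galilean covariance -/

section Reduction

/-- **KNSS's §4 regularity for drift-mild pairs from the regularity of bounded mild solutions,
by the Galilean change of frame.** Assume the Galilean covariance of the drift-mild class
(`IsKNSSDriftMild.GalileanCovariance ℝ³`) and the zero-drift regularity fact
`KNSS2009_mild_regularity` (KNSS 2009, Prop. 4.1 / §4 (4.8)–(4.11) for bounded mild
solutions). Then `KNSS2009_driftMild_regularity` holds: for a drift-mild pair `(U, b)` with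
bound `N`, the co-moving field `V(t, y) = U(t, y + B(t))`, `B = ∫ b`, is a bounded mild solution
with the same bound, so `V` has smooth divergence-free slices with the uniform bounds
`C(k, δ)`, `L(k, δ)` and satisfies the integrated vorticity equation; and
`U(t, x) = V(t, x − B(t))`: translation preserves `C^∞`, `div = 0` and every `‖∇ᵏ·‖`
(constants `C(k, δ)` unchanged); `∇ᵏU` is Lipschitz in time with constant
`L(k, δ) + C(k+1, δ) N` (time increment of `∇ᵏV` plus the mean value inequality in `x` over
the frame displacement `‖B(t) − B(s)‖ ≤ N|t − s|`); and the vorticity `ω(t, x) = ω_V(t, x − B(t))`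
satisfies `ω(t) − ω(s) = ∫ₛᵗ (Δω − Dω[U + b] + DU[ω]) dτ` by the chain rule along the Lipschitz
frame path (`sub_eq_integral_of_path`: the transport term `−Dω_V[b]` produced by the moving
frame is exactly the drift part of `−Dω[U + b]`).
[cite: KochNadirashviliSereginSverak2009, §4 (4.8)–(4.11) with Lemma 3.1 (arXiv:0709.3599v1 pp. 7–8)] -/
theorem KNSS2009_driftMild_regularity_of_mild
    (hK : IsKNSSDriftMild.GalileanCovariance (EuclideanSpace ℝ (Fin 3)))
    (hreg : KNSS2009_mild_regularity) : KNSS2009_driftMild_regularity := by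
  intro N T hT
  obtain ⟨C, L, hCL⟩ := hreg N T hT
  refine ⟨C, fun k δ => L k δ + C (k + 1) δ * N, fun U b hUb => ?_⟩
  -- the co-moving field is a bounded mild solution
  set B : ℝ → EuclideanSpace ℝ (Fin 3) := driftPath b with hB
  set V : ℝ → EuclideanSpace ℝ (Fin 3) → EuclideanSpace ℝ (Fin 3) := galileanShift U b with hV
  have hVm : IsKNSSDriftMild T N V 0 := hK hUb
  obtain ⟨h1, h2, h3, h4, h5⟩ := hCL hVm
  have hbN : ∀ t, ‖b t‖ ≤ N := hUb.norm_drift_le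
  have hbm : AEStronglyMeasurable b volume := hUb.measurable_drift.aestronglyMeasurable
  -- back to the fixed frame
  have hUV : ∀ t x, U t x = V t (x - B t) := fun t x => by
    simp [hV, hB]
  have hUVfun : ∀ t, U t = fun x => V t (x - B t) := fun t => funext (hUV t)
  have hfd : ∀ t x, fderiv ℝ (U t) x = fderiv ℝ (V t) (x - B t) := fun t x => by
    rw [hUVfun t]; exact fderiv_comp_sub_right (V t) (B t) x
  have hcurl : ∀ t x, curl (U t) x = curl (V t) (x - B t) := fun t x => by
    rw [curl_eq_curlCLM, curl_eq_curlCLM, hfd]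
  have hcurlfun : ∀ t, curl (U t) = fun x => curl (V t) (x - B t) := fun t => funext (hcurl t)
  have hiter : ∀ (k : ℕ) t x, iteratedFDeriv ℝ k (U t) x = iteratedFDeriv ℝ k (V t) (x - B t) :=
    fun k t x => by rw [hUVfun t]; exact iteratedFDeriv_comp_sub_right k (V t) (B t) x
  refine ⟨fun t ht => ?_, fun t ht x => ?_, fun δ hδ k t ht x => ?_,
    fun δ hδ k s hs t ht x => ?_, fun x s t hs hst htT => ?_⟩
  · -- (1) smooth slices
    rw [hUVfun t]
    exact (h1 t ht).comp (contDiff_id.sub contDiff_const)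
  · -- (2) divergence-free slices
    rw [hUVfun t, divergence_comp_sub_right]
    exact h2 t ht _
  · -- (3) derivative bounds ((4.10))
    rw [hiter]
    exact h3 δ hδ k t ht _
  · -- (4) Lipschitz in time ((4.11))
    rw [hiter, hiter]
    have hsT : s ∈ Ioo 0 T := ⟨hδ.trans hs.1, hs.2⟩
    have e : iteratedFDeriv ℝ k (V t) (x - B t) - iteratedFDeriv ℝ k (V s) (x - B s) =
        (iteratedFDeriv ℝ k (V t) (x - B t) - iteratedFDeriv ℝ k (V s) (x - B t)) +
        (iteratedFDeriv ℝ k (V s) (x - B t) - iteratedFDeriv ℝ k (V s) (x - B s)) := by abel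
    rw [e]
    have hA := h4 δ hδ k s hs t ht (x - B t)
    have hC0 : 0 ≤ C (k + 1) δ := (norm_nonneg _).trans (h3 δ hδ (k + 1) s hs x)
    have hmv : ‖iteratedFDeriv ℝ k (V s) (x - B t) - iteratedFDeriv ℝ k (V s) (x - B s)‖ ≤
        C (k + 1) δ * ‖(x - B t) - (x - B s)‖ := by
      refine (convex_univ).norm_image_sub_le_of_norm_fderiv_le (𝕜 := ℝ)
        (f := iteratedFDeriv ℝ k (V s)) (fun y _ => ?_) (fun y _ => ?_) (mem_univ _) (mem_univ _)
      · exact ((h1 s hsT).differentiable_iteratedFDeriv (m := k)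
          (by exact_mod_cast ENat.coe_lt_top k)) y
      · rw [norm_fderiv_iteratedFDeriv]
        exact h3 δ hδ (k + 1) s hs y
    have hBst : ‖(x - B t) - (x - B s)‖ ≤ N * |t - s| := by
      rw [sub_sub_sub_cancel_left]
      exact (norm_driftPath_sub_le hbm hbN t s).trans_eq (by rw [abs_sub_comm])
    calc ‖(iteratedFDeriv ℝ k (V t) (x - B t) - iteratedFDeriv ℝ k (V s) (x - B t)) +
          (iteratedFDeriv ℝ k (V s) (x - B t) - iteratedFDeriv ℝ k (V s) (x - B s))‖
        ≤ L k δ * |t - s| + C (k + 1) δ * (N * |t - s|) :=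
          (norm_add_le _ _).trans
            (add_le_add hA (hmv.trans (mul_le_mul_of_nonneg_left hBst hC0)))
      _ = (L k δ + C (k + 1) δ * N) * |t - s| := by ring
  · -- (5) the integrated vorticity equation in the fixed frame
    -- the vorticity-equation integrand of `V`
    set Ξ : ℝ → EuclideanSpace ℝ (Fin 3) → EuclideanSpace ℝ (Fin 3) := fun τ z =>
      (Δ (curl (V τ))) z - fderiv ℝ (curl (V τ)) z (V τ z) + fderiv ℝ (V τ) z (curl (V τ) z)
      with hΞ
    -- joint continuity on `(s/2, T) × ℝ³`
    have hS : Icc s t ⊆ Ioo (s / 2) T := fun σ hσ => ⟨by linarith [hσ.1], hσ.2.trans_lt htT⟩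
    have h1S : ∀ τ ∈ Ioo (s / 2) T, ContDiff ℝ ∞ (V τ) := fun τ hτ =>
      h1 τ ⟨(half_pos hs).trans hτ.1, hτ.2⟩
    have h4S : ∀ k : ℕ, ∀ τ ∈ Ioo (s / 2) T, ∀ τ' ∈ Ioo (s / 2) T, ∀ x,
        ‖iteratedFDeriv ℝ k (V τ) x - iteratedFDeriv ℝ k (V τ') x‖ ≤ L k (s / 2) * |τ - τ'| :=
      fun k τ hτ τ' hτ' x => h4 (s / 2) (half_pos hs) k τ' hτ' τ hτ x
    obtain ⟨hDcurl, hΞc⟩ := continuousOn_vorticityIntegrand h1S h4S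
    -- the moving-frame FTC along `z(σ) = x − B(σ)`
    have key := sub_eq_integral_of_path (Φ := fun σ => curl (V σ)) (φ := Ξ)
      (z := fun σ => x - B σ) (z' := fun σ => -b σ) hst
      (fun σ hσ w => ?_) (hΞc.mono (prod_mono hS Subset.rfl))
      (fun σ hσ => (contDiff_curl (n := 1) (contDiff_infty.1 (h1S σ (hS hσ)) 2)).differentiable
        one_ne_zero)
      (hDcurl.mono (prod_mono hS Subset.rfl)) hbm.neg (N := N)
      (fun σ => by rw [norm_neg]; exact hbN σ) (fun σ _ => ?_)
    rotate_left
    · -- the time representation of `curl V` from the vorticity identity of `V`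
      have h := h5 w s σ hs hσ.1 (hσ.2.trans_lt htT)
      rw [sub_eq_iff_eq_add'] at h
      simpa [hΞ] using h
    · -- the frame path
      show x - driftPath b σ = x - driftPath b s + ∫ ρ in s..σ, -b ρ
      rw [intervalIntegral.integral_neg, driftPath_eq_add hbm hbN s σ]
      abel
    -- rewrite everything in the fixed frame
    rw [hcurl, hcurl, key]
    refine intervalIntegral.integral_congr fun σ _ => ?_
    simp only [hΞ]
    rw [hcurlfun σ, laplacian_comp_sub_right, fderiv_comp_sub_right, hfd σ x, hUV σ x, map_add,
      map_neg]
    abel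

/-- **The window regularity fact from Lemma 3.1, Galilean covariance and the regularity of
bounded mild solutions** (composition of `KNSS2009_regularity_boundedWeak_window_of_driftMild`
with `KNSS2009_driftMild_regularity_of_mild`).
[cite: KochNadirashviliSereginSverak2009, §4 closing paragraph with Lemma 3.1 and Prop. 4.1 (arXiv:0709.3599v1 pp. 7–8)] -/
theorem KNSS2009_regularity_boundedWeak_window_of_mild (h31 : KNSS2009_weak_driftMild)
    (hK : IsKNSSDriftMild.GalileanCovariance (EuclideanSpace ℝ (Fin 3)))
    (hreg : KNSS2009_mild_regularity) : KNSS2009_regularity_boundedWeak_window :=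
  KNSS2009_regularity_boundedWeak_window_of_driftMild h31
    (KNSS2009_driftMild_regularity_of_mild hK hreg)

/-- **The ancient regularity fact from Lemma 3.1, Galilean covariance and the regularity of
bounded mild solutions** (`KNSS2009_regularity_boundedWeak_ancient_of_window` composed with
`KNSS2009_regularity_boundedWeak_window_of_mild`): the input "by the results of Section 4, we
have `|∇ᵏₓu| ≤ C_k` in `ℝ³ × (−∞, 0)`" of the proofs of KNSS's Theorems 5.2–5.3.
[cite: KochNadirashviliSereginSverak2009, §5 proof of Thm 5.2, first sentence (arXiv:0709.3599v1 p. 10), with §4 and Lemma 3.1] -/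
theorem KNSS2009_regularity_boundedWeak_ancient_of_mild (h31 : KNSS2009_weak_driftMild)
    (hK : IsKNSSDriftMild.GalileanCovariance (EuclideanSpace ℝ (Fin 3)))
    (hreg : KNSS2009_mild_regularity) : KNSS2009_regularity_boundedWeak_ancient :=
  KNSS2009_regularity_boundedWeak_ancient_of_window
    (KNSS2009_regularity_boundedWeak_window_of_mild h31 hK hreg)

end Reduction

end Literature.Analysis.FluidPDE

end
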